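import Summits.CriticalPhenomena.PercolationContinuityZ3.Theorems.Transplant.Bcc111ClawTable5
import Summits.CriticalPhenomena.PercolationContinuityZ3.Theorems.Transplant.Bcc111ClawSymm
import HarnessLib

/-!
# The bcc (111)-films `F_m(bcc)`, exit-form routing certificate V⁵: SOUNDNESS of the rule `clawH5` and a claw WITH BOTH HUB EXTREMES KEPT for every block class

builds on p205010 (kernel theorem, internal audit signed; external expert review pending) — NOT used in this file.
Lane `prim-bschramm`, seat `prim-bschramm-p2` (gen 48; class C1b, METHOD = input substitution; memo `HOME/bschramm/P2-LATTICES.md` §159); helper file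
(`--supports stmt-CriticalPhenomena-4575 --as helper`).  `clawH5_sound` (verbatim «Bcc111ClawSound».`clawH_sound` for the strengthened hub test, recording `¬rem0 Q ∧ ¬remM Q`) and
**`exists_claw5`**: for every block class and admissible configuration a claw whose hub column keeps both extreme vertices, from the kernel statements `ClawHOK5` of the ten classes
`t_R = t_D = 3` (the mirrored classes by «Bcc111ClawSymm»).
[cite: DuminilCopinSidoraviciusTassion2016, §2.3 (proof of Fact 2)]
-/

namespace Summit.CriticalPhenomena.PercolationContinuityZ3.Theorems.Transplant

namespace Bcc111Claw

open BccClawX (Pt)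

/-- An `if … then none else x` equal to `some y`. [folklore] -/
private theorem ite_none_some' {α : Type} {p : Prop} [Decidable p] {x : Option α} {y : α} (h : (if p then none else x) = some y) :
    ¬ p ∧ x = some y := by
  by_cases hp : p
  · rw [if_pos hp] at h; exact absurd h (by simp)
  · rw [if_neg hp] at h; exact ⟨hp, h⟩

/-- **SOUNDNESS OF THE RULE `clawH5`** (as `clawH_sound`, plus: both extreme vertices of the hub column are kept). [folklore] -/
theorem clawH5_sound {tR tD sR sD : ℕ} {a1 a2 a3 : Pt} {ty : ℕ} {Q : Pt} {i : ℕ} {up : Bool} {j k xi : ℕ} {l1 l2 l3 : List Pt}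
    (h : clawH5 tR tD sR sD a1 a2 a3 ty = some (Q, i, up, j, k, xi, l1, l2, l3)) :
    ∃ bc F0 F1 X0 X1 s1 s2 s3 : Pt, ClawProps tR tD sR sD a1 a2 a3 ty Q i up bc F0 F1 X0 X1 s1 s2 s3 l1 l2 l3 ∧ rem0 tR sR Q = false ∧ remM tR sR Q = false := by
  unfold clawH5 at h
  obtain ⟨⟨Q', i', up'⟩, hQmem, hQ⟩ := List.exists_of_findSome?_eq_some h
  simp only at hQ
  generalize hh : hubCols Q' i' up' = hc at hQ
  obtain ⟨bc, F0, F1, X0, X1⟩ := hc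
  simp only at hQ
  obtain ⟨hcond, hQ'⟩ := ite_none_some' hQ
  obtain ⟨⟨j', k', xi'⟩, -, hA⟩ := List.exists_of_findSome?_eq_some hQ'
  simp only at hA
  generalize hs : starts F0 F1 X0 X1 j' k' xi' = st at hA
  obtain ⟨s1, s2, s3⟩ := st
  simp only at hA
  obtain ⟨m1, hm1, h1⟩ := List.exists_of_findSome?_eq_some hA
  obtain ⟨m2, hm2, h2⟩ := List.exists_of_findSome?_eq_some h1
  rw [List.mem_filter] at hm1 hm2
  obtain ⟨hdisj, h2'⟩ := ite_none_some' h2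
  simp only [Option.map_eq_some_iff] at h2'
  obtain ⟨m3, hm3, hx⟩ := h2'
  have hp3 := List.find?_some hm3
  have hm3' := List.mem_of_find?_eq_some hm3
  rw [List.mem_filter] at hm3'
  simp only [Prod.mk.injEq] at hx
  obtain ⟨rfl, rfl, rfl, rfl, rfl, rfl, rfl, rfl, rfl⟩ := hx
  simp only [Bool.or_eq_true, Bool.not_eq_true', beq_iff_eq, Bool.and_eq_true, Bool.not_eq_false, not_or,
    decide_eq_false_iff_not, not_le, beq_eq_false_iff_ne, ne_eq, not_lt] at hcond hm1 hm2 hm3' hp3 hdisj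
  have hsame : (a1 == a2) = true ↔ a1 = a2 := beq_iff_eq
  refine ⟨bc, F0, F1, X0, X1, s1, s2, s3, ⟨hh, i_le_two_of_mem_hubs hQmem, ?_, ?_, ?_, ?_, ?_, ?_, ?_, by rw [← hs]; exact starts_spec _ _ _ _ _ _ _,
    ?_, ?_, legOK_sound hm3'.2, ?_, ?_, ?_, ?_, ?_⟩, by simpa using hcond.1.1.1.1.1.2, by simpa using hcond.1.1.1.1.2⟩
  · simpa using hcond.1.1.1.1.1.1.1.1.1.1
  · exact hcond.1.1.1.1.1.1.1.1.1.2
  · exact ⟨hcond.1.1.1.1.1.1.1.1.2, hcond.1.1.1.1.1.1.1.2, hcond.1.1.1.1.1.1.2⟩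
  · intro _; simpa using hcond.1.1.1.1.1.2
  · intro _; simpa using hcond.1.1.1.1.2
  · simpa using hcond.1.1.1.2
  · exact ⟨hcond.1.1.2, hcond.1.2, hcond.2⟩
  · simpa using legOK_sound hm1.2.1
  · simpa using legOK_sound hm2.2.1
  · intro he
    rcases hm1.2.2 with hne | hp
    · exact absurd (hsame.2 he) (by simp [hne])
    · exact hp
  · intro he
    rcases hm2.2.2 with hne | hp
    · exact absurd (hsame.2 he) (by simp [hne])
    · exact hp
  · intro w hw hw2
    have := disjH_sound hdisj w hw hw2
    exact ⟨hsame.1 this.1, this.2⟩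
  · intro w hw hw1
    have := disjH_sound hp3.1 w hw hw1
    simp at this
  · intro w hw hw2
    have := disjH_sound hp3.2 w hw hw2
    simp at this


/-- **A CLAW WITH BOTH HUB EXTREMES KEPT, FOR EVERY ADMISSIBLE CONFIGURATION OF EVERY BLOCK CLASS**, from the kernel statements `ClawHOK5` of the ten classes `t_R = t_D = 3`.
[cite: DuminilCopinSidoraviciusTassion2016, §2.3 (proof of Fact 2)] -/
theorem exists_claw5 (hK : ∀ sR sD : ℕ, sR ≤ sD → sD ≤ 3 → ClawHOK5 sR sD) {tR tD sR sD : ℕ} (hRD : tR ≤ tD) (hD3 : tD ≤ 3) (hSD : sR ≤ sD) (hE3 : sD ≤ 3)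
    (hone : tR = 3 ∨ sR = 3) {a1 a2 a3 : Pt} {ty : ℕ} (hty : ty < 10) (hadm : admissible tR tD sR sD a1 a2 a3 ty = true) :
    ∃ (Q : Pt) (i : ℕ) (up : Bool) (bc F0 F1 X0 X1 s1 s2 s3 : Pt) (l1 l2 l3 : List Pt),
      ClawProps tR tD sR sD a1 a2 a3 ty Q i up bc F0 F1 X0 X1 s1 s2 s3 l1 l2 l3 ∧ rem0 tR sR Q = false ∧ remM tR sR Q = false := by
  have hty' : ty ∈ List.range 10 := List.mem_range.2 hty
  have hmem : ∀ {tR tD sR sD : ℕ} {a1 a2 a3 : Pt} {ty : ℕ}, admissible tR tD sR sD a1 a2 a3 ty = true → a1 ∈ hexPts ∧ a2 ∈ hexPts ∧ a3 ∈ hexPts := by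
    intro tR tD sR sD a1 a2 a3 ty h
    rw [admissible_eq] at h
    simp only [Bool.and_eq_true] at h
    obtain ⟨⟨⟨h1, h2⟩, h3⟩, -⟩ := h
    have e1 : inRB tR sR a1 = true := by simp only [certE, Bool.and_eq_true] at h1; exact h1.1.1
    have e2 : inRB tR sR a2 = true := by simp only [certE, Bool.and_eq_true] at h2; exact h2.1.1
    have e3 : inDB tR tD sR sD a3 = true := by simp only [certW, Bool.and_eq_true] at h3; exact h3.1.1.1.1
    simp only [inRB, inDB, Bool.and_eq_true] at e1 e2 e3
    exact ⟨mem_hexPts_of_inBlk e1.1, mem_hexPts_of_inBlk e2.1, mem_hexPts_of_inBlk e3.1⟩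
  rcases hone with rfl | rfl
  · have htD : tD = 3 := le_antisymm hD3 hRD
    subst htD
    obtain ⟨h1, h2, h3⟩ := hmem hadm
    have hs := clawH5_isSome_of_clawHOK5 (hK sR sD hSD hE3) h1 h2 h3 hty' hadm
    obtain ⟨⟨Q, i, up, j, k, xi, l1, l2, l3⟩, hc⟩ := Option.isSome_iff_exists.1 hs
    obtain ⟨bc, F0, F1, X0, X1, s1, s2, s3, hP, h0, hM⟩ := clawH5_sound hc
    exact ⟨Q, i, up, bc, F0, F1, X0, X1, s1, s2, s3, l1, l2, l3, hP, h0, hM⟩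
  · have hsD : sD = 3 := le_antisymm hE3 hSD
    subst hsD
    have hadm' : admissible 3 3 tR tD (Mp a1) (Mp a2) (Mp a3) ty = true := by rw [admissible_Mp]; exact hadm
    obtain ⟨h1, h2, h3⟩ := hmem hadm'
    have hs := clawH5_isSome_of_clawHOK5 (hK tR tD hRD hD3) h1 h2 h3 hty' hadm'
    obtain ⟨⟨Q, i, up, j, k, xi, l1, l2, l3⟩, hc⟩ := Option.isSome_iff_exists.1 hs
    obtain ⟨bc, F0, F1, X0, X1, s1, s2, s3, hP, h0, hM⟩ := clawH5_sound hc
    obtain ⟨F0', F1', X0', X1', hP'⟩ := ClawProps.ofMp hP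
    exact ⟨_, _, _, _, _, _, _, _, _, _, _, _, _, _, hP', by rw [rem0_Mp]; exact h0, by rw [remM_Mp]; exact hM⟩

end Bcc111Claw

end Summit.CriticalPhenomena.PercolationContinuityZ3.Theorems.Transplant
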